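import Literature.Probability.RandomPlanarGeometry.SAWPulledFreeEnergyZ2Sharp
import Literature.Probability.RandomPlanarGeometry.SAWBridges
import Mathlib.Order.LiminfLimsup
import Mathlib.Topology.Algebra.Order.LiminfLimsup
import Mathlib.Analysis.SpecificLimits.Basic
import HarnessLib

/-!
# The pulled free energy at `y = 2` on `ℤ²`: `log 3.602305 ≤ liminf N⁻¹ log Z^B_N(2)`, `limsup N⁻¹ log Z_N(log 2) ≤ log 3.6030065`

Topic `Literature/Probability/RandomPlanarGeometry` (continues `SAWPulledFreeEnergyZ2Sharp.lean`). The finite-`N`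
enclosure `κ·(1250/347)^N ≤ Z^B_N(2) ≤ Z_N(log 2) ≤ 2⁴¹·(7206013/2000000)^N` (`pulled_enclosure_two_sharp`) read as
statements about the free energies WITHOUT assuming that any limit exists (junk-free `liminf`/`limsup` forms):
`liminf_log_pulledBridgeZ_two_ge`, `limsup_log_driftZ_two_le`, and the finite-`N` logarithmic forms
`log_pulledBridgeZ_two_ge`, `log_driftZ_two_le`. Source for the objects: Beaton (2015) [Beaton2015]; the free energy
`λ(y) = lim N⁻¹ log Z_N(y)` exists (van Rensburg 2009, Ioffe–Velenik 2008) but that is not used here.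
-/

open Filter Topology Literature.Probability.LatticeModels
open scoped BigOperators

namespace Literature.Probability.RandomPlanarGeometry.SAW

/-- `Z^B_N(y) > 0` on `ℤ²` for `y > 0` (there is a bridge of every length). [cite: Beaton2015, §2] -/
theorem pulledBridgeZ_two_pos (N : ℕ) {y : ℝ} (hy : 0 < y) : 0 < Zd.pulledBridgeZ 2 N y := by
  rw [Zd.pulledBridgeZ_eq_sum_bridges]
  have hne : (Zd.bridges 2 N).Nonempty := by
    rw [← Finset.card_pos]
    exact Zd.one_le_bridgeCount N
  exact Finset.sum_pos (fun ω _ => pow_pos hy _) hne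

/-- `Z_N(θ) > 0` on `ℤ²` at `θ = log y`, `y > 0` (it dominates `Z^B_N(y) > 0`). [cite: Beaton2015, §2] -/
theorem driftZ_two_log_pos (N : ℕ) {y : ℝ} (hy : 0 < y) : 0 < Zd.driftZ 2 N (Real.log y) :=
  lt_of_lt_of_le (pulledBridgeZ_two_pos N hy) (Zd.pulledBridgeZ_le_driftZ 2 N hy)

/-- **Finite-`N` lower form**: `log(1250/347) + (log κ)/N ≤ N⁻¹ log Z^B_N(2)` for `N ≥ 1`, with the `κ > 0` of
`pulledBridgeZ_two_lower_sharp`. [cite: Beaton2015, Lemma 2] -/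
theorem log_pulledBridgeZ_two_ge :
    ∃ κ : ℝ, 0 < κ ∧ ∀ N : ℕ, 1 ≤ N →
      Real.log (1250 / 347) + Real.log κ / N ≤ Real.log (Zd.pulledBridgeZ 2 N 2) / N := by
  obtain ⟨κ, hκ, h⟩ := pulledBridgeZ_two_lower_sharp
  refine ⟨κ, hκ, fun N hN => ?_⟩
  have hN0 : (0 : ℝ) < N := by exact_mod_cast hN
  have hZ : 0 < Zd.pulledBridgeZ 2 N 2 := pulledBridgeZ_two_pos N (by norm_num)
  have h1 : Real.log (κ * (1250 / 347 : ℝ) ^ N) ≤ Real.log (Zd.pulledBridgeZ 2 N 2) :=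
    Real.log_le_log (by positivity) (h N)
  rw [Real.log_mul hκ.ne' (by positivity), Real.log_pow] at h1
  have e : Real.log (1250 / 347) + Real.log κ / N = (Real.log κ + N * Real.log (1250 / 347)) / N := by
    field_simp
    ring
  rw [e]
  exact div_le_div_of_nonneg_right h1 hN0.le

/-- **Finite-`N` upper form**: `N⁻¹ log Z_N(log 2) ≤ log(7206013/2000000) + 41 log 2 / N` for `N ≥ 1`.
[cite: PonitzTittmann2000, §3] -/
theorem log_driftZ_two_le (N : ℕ) (hN : 1 ≤ N) :
    Real.log (Zd.driftZ 2 N (Real.log 2)) / N ≤ Real.log (7206013 / 2000000) + 41 * Real.log 2 / N := by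
  have hN0 : (0 : ℝ) < N := by exact_mod_cast hN
  have hZ : 0 < Zd.driftZ 2 N (Real.log 2) := driftZ_two_log_pos N (by norm_num)
  have h1 : Real.log (Zd.driftZ 2 N (Real.log 2)) ≤ Real.log (2 ^ 41 * (7206013 / 2000000 : ℝ) ^ N) :=
    Real.log_le_log hZ (driftZ_two_upper N)
  rw [Real.log_mul (by positivity) (by positivity), Real.log_pow, Real.log_pow] at h1
  rw [div_le_iff₀ hN0, add_mul, div_mul_cancel₀ _ hN0.ne']
  push_cast at h1 ⊢
  linarith

/-- **The bridge free energy at `y = 2` is at least `log 3.602305`**, in `liminf` form (no limit assumed):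
`log(1250/347) ≤ liminf_N N⁻¹ log Z^B_N(2)`. [cite: Beaton2015, Theorem 1 and Lemma 2] -/
theorem liminf_log_pulledBridgeZ_two_ge :
    Real.log (1250 / 347) ≤ liminf (fun N : ℕ => Real.log (Zd.pulledBridgeZ 2 N 2) / N) atTop := by
  obtain ⟨κ, hκ, h⟩ := log_pulledBridgeZ_two_ge
  set u : ℕ → ℝ := fun N => Real.log (Zd.pulledBridgeZ 2 N 2) / N with hu
  set v : ℕ → ℝ := fun N => Real.log (1250 / 347) + Real.log κ / N with hv
  have hvt : Tendsto v atTop (𝓝 (Real.log (1250 / 347))) := by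
    have h0 : Tendsto (fun N : ℕ => Real.log κ / (N : ℝ)) atTop (𝓝 0) :=
      tendsto_const_nhds.div_atTop tendsto_natCast_atTop_atTop
    simpa [hv] using tendsto_const_nhds.add h0
  have hvu : ∀ᶠ N in atTop, v N ≤ u N := by
    filter_upwards [eventually_ge_atTop 1] with N hN using h N hN
  -- `u` is bounded above eventually (by the upper side), hence cobounded under `≥`
  have hub : ∀ᶠ N in atTop, u N ≤ Real.log (7206013 / 2000000) + 41 * Real.log 2 := by
    filter_upwards [eventually_ge_atTop 1] with N hN
    have hN0 : (0 : ℝ) < N := by exact_mod_cast hN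
    have hN1 : (1 : ℝ) ≤ N := by exact_mod_cast hN
    have h1 : u N ≤ Real.log (Zd.driftZ 2 N (Real.log 2)) / N := by
      rw [hu]
      exact div_le_div_of_nonneg_right (Real.log_le_log (pulledBridgeZ_two_pos N (by norm_num))
        (Zd.pulledBridgeZ_le_driftZ 2 N (by norm_num))) hN0.le
    have h2 := log_driftZ_two_le N hN
    have h3 : 41 * Real.log 2 / (N : ℝ) ≤ 41 * Real.log 2 := by
      rw [div_le_iff₀ hN0]
      have : 0 ≤ 41 * Real.log 2 := by positivity
      nlinarith
    linarith
  have hcob : IsCoboundedUnder (· ≥ ·) atTop u :=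
    IsBoundedUnder.isCoboundedUnder_ge ⟨_, hub⟩
  have hvb : IsBoundedUnder (· ≥ ·) atTop v := hvt.isBoundedUnder_ge
  rw [← hvt.liminf_eq]
  exact liminf_le_liminf hvu hvb hcob

/-- **The full free energy at `y = 2` is at most `log 3.6030065`**, in `limsup` form (no limit assumed):
`limsup_N N⁻¹ log Z_N(log 2) ≤ log(7206013/2000000)`. [cite: Beaton2015, Theorem 1; PonitzTittmann2000, §3] -/
theorem limsup_log_driftZ_two_le :
    limsup (fun N : ℕ => Real.log (Zd.driftZ 2 N (Real.log 2)) / N) atTop ≤ Real.log (7206013 / 2000000) := by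
  obtain ⟨κ, hκ, h⟩ := log_pulledBridgeZ_two_ge
  set w : ℕ → ℝ := fun N => Real.log (Zd.driftZ 2 N (Real.log 2)) / N with hw
  set v : ℕ → ℝ := fun N => Real.log (7206013 / 2000000) + 41 * Real.log 2 / N with hv
  have hvt : Tendsto v atTop (𝓝 (Real.log (7206013 / 2000000))) := by
    have h0 : Tendsto (fun N : ℕ => 41 * Real.log 2 / (N : ℝ)) atTop (𝓝 0) :=
      tendsto_const_nhds.div_atTop tendsto_natCast_atTop_atTop
    simpa [hv] using tendsto_const_nhds.add h0
  have hwv : ∀ᶠ N in atTop, w N ≤ v N := by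
    filter_upwards [eventually_ge_atTop 1] with N hN using log_driftZ_two_le N hN
  -- `w` is bounded below eventually (by the lower side), hence cobounded under `≤`
  have hwb : ∀ᶠ N in atTop, Real.log (1250 / 347) - |Real.log κ| ≤ w N := by
    filter_upwards [eventually_ge_atTop 1] with N hN
    have hN0 : (0 : ℝ) < N := by exact_mod_cast hN
    have hN1 : (1 : ℝ) ≤ N := by exact_mod_cast hN
    have h1 : Real.log (Zd.pulledBridgeZ 2 N 2) / N ≤ w N := by
      rw [hw]
      exact div_le_div_of_nonneg_right (Real.log_le_log (pulledBridgeZ_two_pos N (by norm_num))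
        (Zd.pulledBridgeZ_le_driftZ 2 N (by norm_num))) hN0.le
    have h2 := h N hN
    have h3 : -|Real.log κ| ≤ Real.log κ / (N : ℝ) := by
      rw [le_div_iff₀ hN0]
      have := neg_abs_le (Real.log κ)
      have hab := abs_nonneg (Real.log κ)
      nlinarith
    linarith
  have hcob : IsCoboundedUnder (· ≤ ·) atTop w :=
    IsBoundedUnder.isCoboundedUnder_le ⟨_, hwb⟩
  have hvb : IsBoundedUnder (· ≤ ·) atTop v := hvt.isBoundedUnder_le
  rw [← hvt.limsup_eq]
  exact limsup_le_limsup hwv hcob hvb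

end Literature.Probability.RandomPlanarGeometry.SAW
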